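import Literature.RepresentationTheory.CompactGroups.DerivationFlows
import Literature.RepresentationTheory.CompactGroups.UnitaryTrick
import HarnessLib

/-!
# One-parameter subgroups of a compact group from point derivations

Continuation of `DerivationFlows`: for a point derivation `δ` of the representative functions
`R = translationFinite G` of a **compact** group `G`, the flow `α_t = exp (t leftDeriv δ)` is right
translation by a continuous one-parameter subgroup `γ_δ : ℝ → G` with tangent `δ`
(Hochschild, *The Structure of Lie Groups* (1965), Ch. II §3, "proper automorphisms" and
Tannaka duality; here without any Lie theory):

* `∫ leftDeriv δ u dμ = 0` for a right invariant finite measure (finite expansion), hence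
  **`∫ α_t u = ∫ u`** (`IsPointDerivation.integral_flow`);
* **equal even moments give equal sup norms** (`norm_eq_of_forall_integral_pow_eq`, for a finite
  measure charging open sets), hence `‖α_t u‖_∞ = ‖u‖_∞` (`norm_flow`, via `α_t(uⁿ) = (α_t u)ⁿ`);
* the **algebra character `u ↦ (α_t u)(1)` of `R` is evaluation at a point** `γ_δ(t)`
  (`exists_flow_apply_one_eq`: a direct compactness argument on `R` using only
  `|χ(u)| ≤ ‖α_t u‖ = ‖u‖` — if not, a finite sum `F = Σ fᵢ² > 0` with `χ(F) = 0` gives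
  `g = 1 - F/‖F‖ ∈ R` with `χ(g) = 1 > ‖g‖`);
* `γ_δ = gammaPt δ`: `α_t u = u(· γ_δ(t))`, and — when `R` separates points (Peter–Weyl, e.g.
  from a heat kernel) — `γ_δ` is a **continuous one-parameter subgroup** (`gammaPt_add`,
  `continuous_gammaPt`: the topology of `G` is initial for `R`), with
  `d/dt u(γ_δ(t))|₀ = δ u` (so `γ_δ` is non-trivial as soon as `δ ≠ 0` on `R`),
  **conjugation equivariance** `g γ_δ(t) g⁻¹ = γ_{δ ∘ κ_g}(t)`, and **commutation**
  `γ_{δ₁}(s) γ_{δ₂}(t) = γ_{δ₂}(t) γ_{δ₁}(s)` whenever `⁅δ₁, δ₂⁆ = 0` on `R` (commuting flows);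
* the derivative of the conjugation action along `γ_δ`:
  `d/dt a(γ_δ(t) · γ_δ(t)⁻¹)|₀ = rightDeriv δ a - leftDeriv δ a` in `C(G, ℝ)`
  (`hasDerivAt_conjTrans_gammaPt`).

Used for the Lie-free structure theorem behind
`Literature.MathematicalPhysics.QuantumLattice.isGroupHeatKernel_unique_up_to_scale`. No named facts.
-/

noncomputable section

open scoped Classical
open NormedSpace Filter Topology MeasureTheory

namespace Literature.RepresentationTheory.CompactGroups

section OneParameter

variable {G : Type*} [TopologicalSpace G] [Group G] [IsTopologicalGroup G] [CompactSpace G]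
  [MeasurableSpace G] [BorelSpace G]

/-! ### The integral of a left-invariant derivative vanishes; the flow preserves the integral -/

/-- The integral over a finite measure as a bounded linear functional on `C(G, ℝ)`. [folklore] -/
def integralCLM (μ : Measure G) [IsFiniteMeasure μ] : C(G, ℝ) →L[ℝ] ℝ :=
  LinearMap.mkContinuous
    { toFun := fun u => ∫ x, u x ∂μ
      map_add' := fun u v => by
        simp only [ContinuousMap.add_apply]
        exact integral_add (u.continuous.integrable_of_hasCompactSupport (HasCompactSupport.of_compactSpace _))
          (v.continuous.integrable_of_hasCompactSupport (HasCompactSupport.of_compactSpace _))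
      map_smul' := fun c u => by
        simp only [ContinuousMap.smul_apply, smul_eq_mul, RingHom.id_apply]
        exact integral_const_mul c _ }
    (μ.real Set.univ) fun u => by
      simp only [LinearMap.coe_mk, AddHom.coe_mk]
      calc ‖∫ x, u x ∂μ‖ ≤ ∫ x, ‖u x‖ ∂μ := norm_integral_le_integral_norm _
        _ ≤ ∫ _, ‖u‖ ∂μ := integral_mono_of_nonneg (ae_of_all _ fun x => norm_nonneg _)
            (integrable_const _) (ae_of_all _ fun x => u.norm_coe_le_norm x)
        _ = μ.real Set.univ * ‖u‖ := by rw [integral_const, smul_eq_mul]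

omit [Group G] [IsTopologicalGroup G] in
/-- Unfolding `integralCLM`. [folklore] -/
@[simp]
theorem integralCLM_apply (μ : Measure G) [IsFiniteMeasure μ] (u : C(G, ℝ)) :
    integralCLM μ u = ∫ x, u x ∂μ := rfl

/-- **The integral of a left-invariant derivative of a point derivation vanishes** for a right
invariant finite measure: with `u(xz) = Σ u(x yᵢ) wᵢ(z)` one has
`leftDeriv δ u = Σ δ(wᵢ) u(· yᵢ)`, so `∫ leftDeriv δ u = (∫ u) δ(Σ wᵢ)`, and integrating the expansion
gives `(∫ u) (Σ wᵢ - 1) = 0`; as `δ 1 = 0`, in either case the integral is `0`. [folklore] -/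
theorem IsPointDerivation.integral_leftDeriv_eq_zero {δ : C(G, ℝ) →ₗ[ℝ] ℝ} (hδ : IsPointDerivation δ)
    (μ : Measure G) [IsFiniteMeasure μ] [μ.IsMulRightInvariant] {u : C(G, ℝ)}
    (hu : u ∈ translationFinite G) : ∫ x, leftDeriv δ u x ∂μ = 0 := by
  obtain ⟨s, w, hw, hexp⟩ := IsTranslationFinite.exists_expansion hu
  -- `leftDeriv δ u = Σ δ(wᵢ) · u(· yᵢ)`
  have hD : ∀ x, leftDeriv δ u x = ∑ y ∈ s, u (x * y) * δ (w y) := by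
    intro x
    rw [leftDeriv_apply δ hu]
    have : lTrans x u = ∑ y ∈ s, (u (x * y)) • w y := by ext z; simp [hexp x z]
    rw [this, map_sum]
    simp
  -- integrate
  have hint : ∀ y, ∫ x, u (x * y) ∂μ = ∫ x, u x ∂μ := fun y => integral_mul_right_eq_self (fun x => u x) y
  have hI : ∫ x, leftDeriv δ u x ∂μ = (∫ x, u x ∂μ) * ∑ y ∈ s, δ (w y) := by
    simp_rw [hD]
    rw [integral_finsetSum _ fun y _ => ?_]
    · simp_rw [integral_mul_const, hint, Finset.mul_sum]
    · exact ((u.continuous.comp (continuous_mul_const y)).mul continuous_const).integrable_of_hasCompactSupport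
        (HasCompactSupport.of_compactSpace _)
  -- the expansion integrated: `(∫ u) = (∫ u) Σ wᵢ(z)`
  have hsumw : ∀ z, (∫ x, u x ∂μ) = (∫ x, u x ∂μ) * ∑ y ∈ s, w y z := by
    intro z
    have h1 : ∫ x, u (x * z) ∂μ = ∫ x, ∑ y ∈ s, u (x * y) * w y z ∂μ :=
      integral_congr_ae (Eventually.of_forall fun x => hexp x z)
    rw [hint] at h1
    have h2 : ∫ x, ∑ y ∈ s, u (x * y) * w y z ∂μ = (∫ x, u x ∂μ) * ∑ y ∈ s, w y z := by
      rw [integral_finsetSum _ fun y _ => ?_]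
      · simp_rw [integral_mul_const, hint, Finset.mul_sum]
      · exact ((u.continuous.comp (continuous_mul_const y)).mul continuous_const).integrable_of_hasCompactSupport
          (HasCompactSupport.of_compactSpace _)
    exact h1.trans h2
  rw [hI]
  by_cases h0 : ∫ x, u x ∂μ = 0
  · rw [h0, zero_mul]
  · have hw1 : ∑ y ∈ s, w y = 1 := by
      ext z
      have h3 : (∫ x, u x ∂μ) * ∑ y ∈ s, w y z = (∫ x, u x ∂μ) * 1 := by
        rw [mul_one]; exact (hsumw z).symm
      have := mul_left_cancel₀ h0 h3
      rw [ContinuousMap.coe_sum, Finset.sum_apply, ContinuousMap.one_apply]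
      exact this
    rw [← map_sum, hw1, hδ.apply_one, mul_zero]

/-- **The flow of a point derivation preserves the integral** of a right invariant finite measure:
`∫ α_t u = ∫ u` (the derivative `∫ leftDeriv δ (α_t u)` vanishes). [folklore] -/
theorem IsPointDerivation.integral_flow {δ : C(G, ℝ) →ₗ[ℝ] ℝ} (hδ : IsPointDerivation δ)
    (μ : Measure G) [IsFiniteMeasure μ] [μ.IsMulRightInvariant] {u : C(G, ℝ)}
    (hu : u ∈ translationFinite G) (t : ℝ) : ∫ x, flow δ t u x ∂μ = ∫ x, u x ∂μ := by
  have hderiv : ∀ s, HasDerivAt (fun s => integralCLM μ (flow δ s u)) 0 s := by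
    intro s
    have h := ((integralCLM μ).hasFDerivAt).comp_hasDerivAt s (hasDerivAt_flow δ hu s)
    rw [show (integralCLM μ) (leftDeriv δ (flow δ s u)) = 0 from by
      rw [integralCLM_apply]; exact hδ.integral_leftDeriv_eq_zero μ (flow_mem δ hu s)] at h
    exact h
  have hconst := is_const_of_deriv_eq_zero (fun s => (hderiv s).differentiableAt) (fun s => (hderiv s).deriv) t 0
  simpa [flow_zero δ hu] using hconst

/-! ### Equal even moments give equal sup norms; the flow is isometric -/

omit [MeasurableSpace G] [BorelSpace G] in
/-- If `|u| ≤ a` everywhere then `‖u‖ ≤ a` (compact domain). [folklore] -/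
theorem norm_le_of_forall_abs_le {X : Type*} [TopologicalSpace X] [CompactSpace X] {u : C(X, ℝ)}
    {a : ℝ} (ha : 0 ≤ a) (h : ∀ x, |u x| ≤ a) : ‖u‖ ≤ a :=
  (ContinuousMap.norm_le u ha).mpr fun x => by rw [Real.norm_eq_abs]; exact h x

/-- **Equal even moments give equal sup norms.** For continuous `u`, `w` on a compact space with a
finite measure charging every open set, `∫ u^{2n} = ∫ w^{2n}` for all `n` forces `‖u‖_∞ ≤ ‖w‖_∞`:
otherwise, with `‖w‖ < a < ‖u‖`, `a^{2n} μ{|u| > a} ≤ ∫ u^{2n} = ∫ w^{2n} ≤ ‖w‖^{2n} μ(X)` for all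
`n`, which is absurd. [folklore] -/
theorem norm_le_of_forall_integral_pow_eq {X : Type*} [TopologicalSpace X] [CompactSpace X]
    [MeasurableSpace X] [OpensMeasurableSpace X] (μ : Measure X) [IsFiniteMeasure μ] [μ.IsOpenPosMeasure]
    {u w : C(X, ℝ)} (h : ∀ n : ℕ, ∫ x, (u x) ^ (2 * n) ∂μ = ∫ x, (w x) ^ (2 * n) ∂μ) : ‖u‖ ≤ ‖w‖ := by
  by_contra hlt
  push Not at hlt
  obtain ⟨a, hwa, hau⟩ := exists_between hlt
  have ha0 : 0 < a := lt_of_le_of_lt (norm_nonneg _) hwa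
  -- the open set `{|u| > a}` is non-empty
  set U : Set X := {x | a < |u x|} with hU
  have hUo : IsOpen U := isOpen_lt continuous_const (by fun_prop)
  have hUne : U.Nonempty := by
    by_contra hempty
    rw [Set.not_nonempty_iff_eq_empty] at hempty
    have : ‖u‖ ≤ a := norm_le_of_forall_abs_le ha0.le fun x => by
      by_contra hx
      have : x ∈ U := not_le.mp hx
      rw [hempty] at this
      exact this
    linarith
  have hUm : MeasurableSet U := hUo.measurableSet
  have hmU : 0 < μ.real U := by
    have := hUo.measure_pos μ hUne
    exact ENNReal.toReal_pos this.ne' (measure_ne_top μ U)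
  set b := ‖w‖ with hb
  set M := μ.real Set.univ with hM
  -- the two bounds
  have hlow : ∀ n : ℕ, a ^ (2 * n) * μ.real U ≤ ∫ x, (u x) ^ (2 * n) ∂μ := by
    intro n
    have hI : Integrable (fun x => (u x) ^ (2 * n)) μ :=
      ((u.continuous).pow _).integrable_of_hasCompactSupport (HasCompactSupport.of_compactSpace _)
    calc a ^ (2 * n) * μ.real U = ∫ x in U, a ^ (2 * n) ∂μ := by
          rw [setIntegral_const, smul_eq_mul, mul_comm]
      _ ≤ ∫ x in U, (u x) ^ (2 * n) ∂μ := by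
          refine setIntegral_mono_on (integrable_const _).integrableOn hI.integrableOn hUm fun x hx => ?_
          have hx' : a < |u x| := hx
          calc a ^ (2 * n) ≤ |u x| ^ (2 * n) := pow_le_pow_left₀ ha0.le hx'.le _
            _ = (u x) ^ (2 * n) := by rw [pow_mul, pow_mul, sq_abs]
      _ ≤ ∫ x, (u x) ^ (2 * n) ∂μ :=
          setIntegral_le_integral hI (ae_of_all _ fun x => show (0 : ℝ) ≤ u x ^ (2 * n) by rw [pow_mul]; positivity)
  have hup : ∀ n : ℕ, ∫ x, (w x) ^ (2 * n) ∂μ ≤ b ^ (2 * n) * M := by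
    intro n
    calc ∫ x, (w x) ^ (2 * n) ∂μ ≤ ∫ _, b ^ (2 * n) ∂μ := by
          refine integral_mono_of_nonneg (ae_of_all _ fun x => show (0 : ℝ) ≤ w x ^ (2 * n) by
              rw [pow_mul]; positivity) (integrable_const _) (ae_of_all _ fun x => ?_)
          calc (w x) ^ (2 * n) = |w x| ^ (2 * n) := by rw [pow_mul, pow_mul, sq_abs]
            _ ≤ b ^ (2 * n) := pow_le_pow_left₀ (abs_nonneg _)
                (by rw [← Real.norm_eq_abs]; exact w.norm_coe_le_norm x) _
      _ = b ^ (2 * n) * M := by rw [integral_const, smul_eq_mul, mul_comm]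
  have hboth : ∀ n : ℕ, a ^ (2 * n) * μ.real U ≤ b ^ (2 * n) * M := fun n =>
    (hlow n).trans ((h n).le.trans (hup n))
  have hb0 : 0 ≤ b := norm_nonneg _
  have hM0 : 0 ≤ M := measureReal_nonneg
  -- `(a/b)^{2n} ≤ M / μ U` for all `n`, impossible since `a/b > 1` (or `b = 0`)
  by_cases hbz : b = 0
  · have := hboth 1
    rw [hbz] at this
    have : a ^ 2 * μ.real U ≤ 0 := by simpa using this
    nlinarith [pow_pos ha0 2]
  · have hbpos : 0 < b := lt_of_le_of_ne hb0 (Ne.symm hbz)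
    set r := (a / b) ^ 2 with hr_def
    have hr : 1 < r := by
      have : 1 < a / b := (one_lt_div hbpos).mpr hwa
      rw [hr_def]; nlinarith
    have key : ∀ n : ℕ, r ^ n * μ.real U ≤ M := by
      intro n
      have h1 := hboth n
      have h2 : r ^ n = a ^ (2 * n) / b ^ (2 * n) := by
        rw [hr_def, ← pow_mul, div_pow]
      rw [h2, div_mul_eq_mul_div, div_le_iff₀ (pow_pos hbpos _)]
      linarith
    have hev := (tendsto_pow_atTop_atTop_of_one_lt hr).eventually_gt_atTop (M / μ.real U)
    obtain ⟨n, hn⟩ := hev.exists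
    have : M < r ^ n * μ.real U := by rwa [div_lt_iff₀ hmU] at hn
    linarith [key n]

/-- Equal even moments give equal sup norms. [folklore] -/
theorem norm_eq_of_forall_integral_pow_eq {X : Type*} [TopologicalSpace X] [CompactSpace X]
    [MeasurableSpace X] [OpensMeasurableSpace X] (μ : Measure X) [IsFiniteMeasure μ] [μ.IsOpenPosMeasure]
    {u w : C(X, ℝ)} (h : ∀ n : ℕ, ∫ x, (u x) ^ (2 * n) ∂μ = ∫ x, (w x) ^ (2 * n) ∂μ) : ‖u‖ = ‖w‖ :=
  le_antisymm (norm_le_of_forall_integral_pow_eq μ h)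
    (norm_le_of_forall_integral_pow_eq μ fun n => (h n).symm)

/-- **The flow of a point derivation is isometric** for the sup norm on `R` (given a right
invariant finite measure charging open sets, e.g. Haar measure): `∫ (α_t u)^{2n} = ∫ α_t(u^{2n}) = ∫ u^{2n}`.
[folklore] -/
theorem IsPointDerivation.norm_flow {δ : C(G, ℝ) →ₗ[ℝ] ℝ} (hδ : IsPointDerivation δ)
    (μ : Measure G) [IsFiniteMeasure μ] [μ.IsOpenPosMeasure] [μ.IsMulRightInvariant]
    {u : C(G, ℝ)} (hu : u ∈ translationFinite G) (t : ℝ) : ‖flow δ t u‖ = ‖u‖ := by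
  refine norm_eq_of_forall_integral_pow_eq μ fun n => ?_
  have h := hδ.integral_flow μ (pow_mem hu (2 * n)) t
  rw [hδ.flow_pow hu t (2 * n)] at h
  simpa using h

/-! ### The character `u ↦ (α_t u)(1)` is evaluation at a point -/

/-- **An algebra character of `R` dominated by the sup norm is a point evaluation.** For the flow of
a point derivation: there is `x ∈ G` with `(α_t u)(1) = u(x)` for all representative `u`. Proof by
compactness: otherwise every `y` has `f_y ∈ R` with `χ(f_y) = 0 ≠ f_y(y)` (`χ = ev₁ ∘ α_t`); a finite
sum `F = Σ f_{yᵢ}²` is `> 0` on `G` with `χ(F) = 0`, and `g = 1 - F/‖F‖ ∈ R` has `‖g‖ < 1 = χ(g)`,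
contradicting `|χ(g)| ≤ ‖α_t g‖ = ‖g‖`. [folklore] -/
theorem IsPointDerivation.exists_flow_apply_one_eq {δ : C(G, ℝ) →ₗ[ℝ] ℝ} (hδ : IsPointDerivation δ)
    (μ : Measure G) [IsFiniteMeasure μ] [μ.IsOpenPosMeasure] [μ.IsMulRightInvariant] (t : ℝ) :
    ∃ x : G, ∀ u ∈ translationFinite G, flow δ t u 1 = u x := by
  -- the character and its properties
  set χ : C(G, ℝ) → ℝ := fun u => flow δ t u 1 with hχ
  have hχ_add : ∀ u ∈ translationFinite G, ∀ v ∈ translationFinite G, χ (u + v) = χ u + χ v :=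
    fun u hu v hv => by simp only [hχ, flow_add δ hu hv, ContinuousMap.add_apply]
  have hχ_smul : ∀ (c : ℝ), ∀ u ∈ translationFinite G, χ (c • u) = c * χ u :=
    fun c u hu => by simp only [hχ, flow_smul δ c hu, ContinuousMap.smul_apply, smul_eq_mul]
  have hχ_mul : ∀ u ∈ translationFinite G, ∀ v ∈ translationFinite G, χ (u * v) = χ u * χ v :=
    fun u hu v hv => by simp only [hχ, hδ.flow_mul hu hv, ContinuousMap.mul_apply]
  have hχ_one : χ 1 = 1 := by simp only [hχ, hδ.flow_one, ContinuousMap.one_apply]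
  have hχ_le : ∀ u ∈ translationFinite G, |χ u| ≤ ‖u‖ := fun u hu => by
    rw [hχ, ← Real.norm_eq_abs, ← hδ.norm_flow μ hu t]
    exact (flow δ t u).norm_coe_le_norm 1
  by_contra hcon
  push Not at hcon
  -- for every `y`, a function `f ∈ R` with `χ f = 0` and `f y ≠ 0`
  have hf : ∀ y : G, ∃ f ∈ translationFinite G, χ f = 0 ∧ f y ≠ 0 := by
    intro y
    obtain ⟨u, hu, hne⟩ := hcon y
    refine ⟨u - χ u • (1 : C(G, ℝ)), (translationFinite G).sub_mem hu
      ((translationFinite G).smul_mem (translationFinite G).one_mem _), ?_, ?_⟩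
    · have h1 : χ (u - χ u • (1 : C(G, ℝ))) = χ u - χ u * χ 1 := by
        rw [sub_eq_add_neg, hχ_add u hu _ ((translationFinite G).neg_mem
          ((translationFinite G).smul_mem (translationFinite G).one_mem _)), ← neg_one_smul ℝ,
          smul_smul, hχ_smul _ _ (translationFinite G).one_mem]
        ring
      rw [h1, hχ_one, mul_one, sub_self]
    · simp only [ContinuousMap.sub_apply, ContinuousMap.smul_apply, ContinuousMap.one_apply,
        smul_eq_mul, mul_one]
      exact sub_ne_zero.mpr hne.symm
  choose f hfR hfχ hfy using hf
  -- finite subcover of `G` by the open sets `{f_y ≠ 0}`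
  obtain ⟨s, hs⟩ := isCompact_univ.elim_finite_subcover (fun y => {z | f y z ≠ 0})
    (fun y => isOpen_ne_fun (f y).continuous continuous_const) fun z _ => Set.mem_iUnion.mpr ⟨z, hfy z⟩
  set F : C(G, ℝ) := ∑ y ∈ s, f y * f y with hF
  have hFR : F ∈ translationFinite G :=
    Subalgebra.sum_mem _ fun y _ => (translationFinite G).mul_mem (hfR y) (hfR y)
  have hFpos : ∀ z, 0 < F z := by
    intro z
    obtain ⟨y, hy, hyz⟩ : ∃ y ∈ s, f y z ≠ 0 := by
      have := hs (Set.mem_univ z)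
      simp only [Set.mem_iUnion, Set.mem_setOf_eq, exists_prop] at this
      exact this
    rw [hF, ContinuousMap.coe_sum, Finset.sum_apply]
    refine lt_of_lt_of_le (mul_self_pos.mpr hyz) ?_
    refine Finset.single_le_sum (f := fun y => (f y * f y) z) (fun i _ => ?_) hy
    simp only [ContinuousMap.mul_apply]; exact mul_self_nonneg _
  have hχF : χ F = 0 := by
    have : ∀ (s' : Finset G), χ (∑ y ∈ s', f y * f y) = ∑ y ∈ s', χ (f y) * χ (f y) := by
      intro s'
      induction s' using Finset.induction_on with
      | empty => simpa using hχ_smul 0 _ (translationFinite G).one_mem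
      | insert a s' ha ih =>
          rw [Finset.sum_insert ha, Finset.sum_insert ha,
            hχ_add _ ((translationFinite G).mul_mem (hfR a) (hfR a)) _
              (Subalgebra.sum_mem _ fun y _ => (translationFinite G).mul_mem (hfR y) (hfR y)),
            hχ_mul _ (hfR a) _ (hfR a), ih]
    rw [hF, this]
    exact Finset.sum_eq_zero fun y _ => by rw [hfχ y, mul_zero]
  -- a positive lower bound of `F`
  obtain ⟨z₀, -, hz₀⟩ := isCompact_univ.exists_isMinOn Set.univ_nonempty F.continuous.continuousOn
  set c := F z₀ with hc
  have hc0 : 0 < c := hFpos z₀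
  have hcle : ∀ z, c ≤ F z := fun z => hz₀ (Set.mem_univ z)
  have hFnorm : 0 < ‖F‖ := lt_of_lt_of_le hc0 (by
    have := F.norm_coe_le_norm z₀
    rw [Real.norm_eq_abs, abs_of_pos hc0] at this
    exact this)
  -- `g = 1 - F/‖F‖`
  set g : C(G, ℝ) := 1 - ‖F‖⁻¹ • F with hg
  have hgR : g ∈ translationFinite G :=
    (translationFinite G).sub_mem (translationFinite G).one_mem ((translationFinite G).smul_mem hFR _)
  have hχg : χ g = 1 := by
    rw [hg, sub_eq_add_neg, hχ_add _ (translationFinite G).one_mem _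
      ((translationFinite G).neg_mem ((translationFinite G).smul_mem hFR _)), ← neg_one_smul ℝ, smul_smul,
      hχ_smul _ _ hFR, hχF, hχ_one]
    ring
  have hgnorm : ‖g‖ ≤ 1 - c / ‖F‖ := by
    refine norm_le_of_forall_abs_le ?_ fun z => ?_
    · rw [sub_nonneg, div_le_one hFnorm]
      have := F.norm_coe_le_norm z₀
      rwa [Real.norm_eq_abs, abs_of_pos hc0] at this
    · have hFz : F z ≤ ‖F‖ := by
        have := F.norm_coe_le_norm z
        rwa [Real.norm_eq_abs, abs_of_pos (hFpos z)] at this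
      have h1 : g z = 1 - F z / ‖F‖ := by
        simp only [hg, ContinuousMap.sub_apply, ContinuousMap.one_apply, ContinuousMap.smul_apply,
          smul_eq_mul]
        ring
      rw [h1, abs_of_nonneg (by rw [sub_nonneg, div_le_one hFnorm]; exact hFz)]
      gcongr
      exact hcle z
  have h1 := hχ_le g hgR
  rw [hχg, abs_one] at h1
  have h2 : 0 < c / ‖F‖ := div_pos hc0 hFnorm
  linarith

end OneParameter


/-! ### The one-parameter subgroup `γ_δ` -/

section Gamma

variable {G : Type*} [TopologicalSpace G] [Group G] [IsTopologicalGroup G] [CompactSpace G]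

/-- The point `γ_δ(t) ∈ G` with `(α_t u)(1) = u(γ_δ(t))` for all representative `u` (junk `1` if
no such point exists, which does not happen for a point derivation of a compact group). [folklore] -/
def gammaPt (δ : C(G, ℝ) →ₗ[ℝ] ℝ) (t : ℝ) : G :=
  if h : ∃ x : G, ∀ u ∈ translationFinite G, flow δ t u 1 = u x then Classical.choose h else 1

variable {δ : C(G, ℝ) →ₗ[ℝ] ℝ}

/-- **`(α_t u)(1) = u(γ_δ(t))`** for a point derivation `δ` of a compact group and representative `u`
(existence of the point via the Haar measure of `G`, `exists_flow_apply_one_eq`). [folklore] -/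
theorem IsPointDerivation.flow_apply_one (hδ : IsPointDerivation δ) {u : C(G, ℝ)}
    (hu : u ∈ translationFinite G) (t : ℝ) : flow δ t u 1 = u (gammaPt δ t) := by
  have hex : ∃ x : G, ∀ u ∈ translationFinite G, flow δ t u 1 = u x := by
    borelize G
    haveI : (Measure.haarMeasure (⊤ : TopologicalSpace.PositiveCompacts G)).IsMulRightInvariant :=
      CompactGroup.isMulRightInvariant_of_isHaarMeasure _
    haveI := CompactGroup.isProbabilityMeasure_haarMeasure_top (G := G)
    exact hδ.exists_flow_apply_one_eq (Measure.haarMeasure ⊤) t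
  rw [gammaPt, dif_pos hex]
  exact Classical.choose_spec hex u hu

/-- **The flow is right translation by `γ_δ(t)`**: `(α_t u)(x) = u(x γ_δ(t))`. [folklore] -/
theorem IsPointDerivation.flow_apply (hδ : IsPointDerivation δ) {u : C(G, ℝ)}
    (hu : u ∈ translationFinite G) (t : ℝ) (x : G) : flow δ t u x = u (x * gammaPt δ t) := by
  have h := hδ.flow_apply_one (lTrans_mem_translationFinite hu x) t
  rw [flow_lTrans δ x hu, lTrans_apply, mul_one, lTrans_apply] at h
  exact h

/-- `α_t u = u(· γ_δ(t))`. [folklore] -/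
theorem IsPointDerivation.flow_eq_rTrans (hδ : IsPointDerivation δ) {u : C(G, ℝ)}
    (hu : u ∈ translationFinite G) (t : ℝ) : flow δ t u = rTrans (gammaPt δ t) u := by
  ext x; rw [hδ.flow_apply hu, rTrans_apply]

omit [CompactSpace G] in
/-- Points on which all representative functions agree are equal, if `R` separates points. [folklore] -/
theorem eq_of_forall_translationFinite_apply_eq (hR : (translationFinite G).SeparatesPoints) {x y : G}
    (h : ∀ u ∈ translationFinite G, u x = u y) : x = y := by
  by_contra hne
  obtain ⟨_, ⟨u, hu, rfl⟩, hxy⟩ := hR hne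
  exact hxy (h u hu)

/-- `γ_δ(0) = 1`. [folklore] -/
theorem IsPointDerivation.gammaPt_zero (hδ : IsPointDerivation δ)
    (hR : (translationFinite G).SeparatesPoints) : gammaPt δ 0 = 1 :=
  eq_of_forall_translationFinite_apply_eq hR fun u hu => by
    rw [← hδ.flow_apply_one hu, flow_zero δ hu]

/-- **`γ_δ` is a one-parameter subgroup**: `γ_δ(s + t) = γ_δ(s) γ_δ(t)`. [folklore] -/
theorem IsPointDerivation.gammaPt_add (hδ : IsPointDerivation δ)
    (hR : (translationFinite G).SeparatesPoints) (s t : ℝ) :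
    gammaPt δ (s + t) = gammaPt δ s * gammaPt δ t :=
  eq_of_forall_translationFinite_apply_eq hR fun u hu => by
    rw [← hδ.flow_apply_one hu, flow_add_time δ hu, hδ.flow_apply (flow_mem δ hu t), one_mul,
      hδ.flow_apply hu]

/-- `γ_δ(-t) = γ_δ(t)⁻¹`. [folklore] -/
theorem IsPointDerivation.gammaPt_neg (hδ : IsPointDerivation δ)
    (hR : (translationFinite G).SeparatesPoints) (t : ℝ) : gammaPt δ (-t) = (gammaPt δ t)⁻¹ := by
  have h := hδ.gammaPt_add hR t (-t)
  rw [add_neg_cancel, hδ.gammaPt_zero hR] at h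
  exact (eq_inv_of_mul_eq_one_right h.symm)

/-- `γ_δ(s)` and `γ_δ(t)` commute. [folklore] -/
theorem IsPointDerivation.gammaPt_comm (hδ : IsPointDerivation δ)
    (hR : (translationFinite G).SeparatesPoints) (s t : ℝ) :
    gammaPt δ s * gammaPt δ t = gammaPt δ t * gammaPt δ s := by
  rw [← hδ.gammaPt_add hR, ← hδ.gammaPt_add hR, add_comm]

omit [CompactSpace G] in
/-- **Continuity test through representative functions**: on a compact Hausdorff group whose
representative functions separate points, a map `γ : X → G` is continuous as soon as all
`u ∘ γ`, `u ∈ R`, are (the evaluation map `G → ℝ^R` is a closed embedding). [folklore] -/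
theorem continuous_of_translationFinite [CompactSpace G] [T2Space G]
    (hR : (translationFinite G).SeparatesPoints) {X : Type*} [TopologicalSpace X] {γ : X → G}
    (h : ∀ u ∈ translationFinite G, Continuous fun x => u (γ x)) : Continuous γ := by
  let ι : G → (translationFinite G → ℝ) := fun g u => (u : C(G, ℝ)) g
  have hιc : Continuous ι := continuous_pi fun u => (u : C(G, ℝ)).continuous
  have hιi : Function.Injective ι := fun x y hxy =>
    eq_of_forall_translationFinite_apply_eq hR fun u hu => congrFun hxy ⟨u, hu⟩
  have hemb := hιc.isClosedEmbedding hιi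
  rw [hemb.isEmbedding.continuous_iff]
  exact continuous_pi fun u => h u u.2

/-- **`γ_δ` is continuous.** [folklore] -/
theorem IsPointDerivation.continuous_gammaPt [T2Space G] (hδ : IsPointDerivation δ)
    (hR : (translationFinite G).SeparatesPoints) : Continuous (gammaPt δ) :=
  continuous_of_translationFinite hR fun u hu => by
    simp_rw [← hδ.flow_apply_one hu]
    exact continuous_flow_apply δ hu 1

/-- The range of `γ_δ` is connected and contains `1`. [folklore] -/
theorem IsPointDerivation.isPreconnected_range_gammaPt [T2Space G] (hδ : IsPointDerivation δ)
    (hR : (translationFinite G).SeparatesPoints) : IsPreconnected (Set.range (gammaPt δ)) :=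
  (isPreconnected_range (hδ.continuous_gammaPt hR))

/-- **Derivative along `γ_δ`**: `d/dt u(γ_δ(t)) = δ(α_t u)`, in particular `= δ u` at `t = 0`:
`γ_δ` has "tangent vector" `δ`. [folklore] -/
theorem IsPointDerivation.hasDerivAt_comp_gammaPt (hδ : IsPointDerivation δ) {u : C(G, ℝ)}
    (hu : u ∈ translationFinite G) (t : ℝ) :
    HasDerivAt (fun s => u (gammaPt δ s)) (δ (flow δ t u)) t := by
  have h := hasDerivAt_flow_apply δ hu 1 t
  simp_rw [hδ.flow_apply_one hu] at h
  rwa [leftDeriv_apply_one δ (flow_mem δ hu t)] at h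

/-- `d/dt u(γ_δ(t)) |_{t=0} = δ u`. [folklore] -/
theorem IsPointDerivation.hasDerivAt_comp_gammaPt_zero (hδ : IsPointDerivation δ) {u : C(G, ℝ)}
    (hu : u ∈ translationFinite G) : HasDerivAt (fun s => u (gammaPt δ s)) (δ u) 0 := by
  have := hδ.hasDerivAt_comp_gammaPt hu 0
  rwa [flow_zero δ hu] at this

/-- **Non-triviality**: if `δ u ≠ 0` for some representative `u`, then `γ_δ` is not identically `1`. [folklore] -/
theorem IsPointDerivation.exists_gammaPt_ne_one (hδ : IsPointDerivation δ) {u : C(G, ℝ)}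
    (hu : u ∈ translationFinite G) (h : δ u ≠ 0) : ∃ t, gammaPt δ t ≠ 1 := by
  by_contra hall
  push Not at hall
  have hconst : (fun s => u (gammaPt δ s)) = fun _ => u 1 := funext fun s => by rw [hall s]
  have hd := hδ.hasDerivAt_comp_gammaPt_zero hu
  rw [hconst] at hd
  exact h (hd.unique (hasDerivAt_const 0 (u 1)))

omit [CompactSpace G] in
/-- `δ ∘ κ_g` is a point derivation if `δ` is. [folklore] -/
theorem IsPointDerivation.comp_conjTrans (hδ : IsPointDerivation δ) (g : G) :
    IsPointDerivation (δ.comp (conjTrans g).toLinearMap) := by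
  intro u hu v hv
  simp only [LinearMap.comp_apply, AlgHom.toLinearMap_apply, map_mul]
  rw [hδ _ (conjTrans_mem_translationFinite g hu) _ (conjTrans_mem_translationFinite g hv)]
  simp

/-- **Conjugation equivariance**: `g γ_δ(t) g⁻¹ = γ_{δ ∘ κ_g}(t)`. [folklore] -/
theorem IsPointDerivation.conj_gammaPt (hδ : IsPointDerivation δ)
    (hR : (translationFinite G).SeparatesPoints) (g : G) (t : ℝ) :
    g * gammaPt δ t * g⁻¹ = gammaPt (δ.comp (conjTrans g).toLinearMap) t :=
  eq_of_forall_translationFinite_apply_eq hR fun u hu => by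
    rw [← (hδ.comp_conjTrans g).flow_apply_one hu, ← conjTrans_apply,
      ← hδ.flow_apply_one (conjTrans_mem_translationFinite g hu), flow_conjTrans δ g hu,
      conjTrans_apply, mul_one, mul_inv_cancel]

/-! ### Commuting flows from a vanishing bracket -/

omit [CompactSpace G] in
/-- If `⁅δ₁, δ₂⁆ = 0` on `R` then the left-invariant derivations commute on `R`. [folklore] -/
theorem leftDeriv_comm_of_bracket_eq_zero {δ₁ δ₂ : C(G, ℝ) →ₗ[ℝ] ℝ}
    (h : ∀ u ∈ translationFinite G, bracket δ₁ δ₂ u = 0) {u : C(G, ℝ)} (hu : u ∈ translationFinite G) :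
    leftDeriv δ₁ (leftDeriv δ₂ u) = leftDeriv δ₂ (leftDeriv δ₁ u) := by
  have h1 := leftDeriv_bracket δ₁ δ₂ hu
  have h0 : leftDeriv (bracket δ₁ δ₂) u = 0 := by
    ext x; rw [leftDeriv_apply _ hu, h _ (lTrans_mem_translationFinite hu x)]; rfl
  rw [h0] at h1
  exact (sub_eq_zero.mp h1.symm)

omit [CompactSpace G] in
/-- **Commuting flows**: if `⁅δ₁, δ₂⁆ = 0` on `R` then `α¹_s ∘ α²_t = α²_t ∘ α¹_s` on `R`
(commuting generators on the common flow domain `biSpan u`). [folklore] -/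
theorem flow_comm_of_bracket_eq_zero {δ₁ δ₂ : C(G, ℝ) →ₗ[ℝ] ℝ}
    (h : ∀ u ∈ translationFinite G, bracket δ₁ δ₂ u = 0) {u : C(G, ℝ)} (hu : u ∈ translationFinite G)
    (s t : ℝ) : flow δ₁ s (flow δ₂ t u) = flow δ₂ t (flow δ₁ s u) := by
  have hF₁ := isFlowDomain_biSpan δ₁ hu
  have hF₂ := isFlowDomain_biSpan δ₂ hu
  -- the two coordinate derivations commute
  have hcomm : Commute (derivVec δ₁ hF₁) (derivVec δ₂ hF₂) := by
    refine ContinuousLinearMap.ext fun c => ?_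
    change derivVec δ₁ hF₁ (derivVec δ₂ hF₂ c) = derivVec δ₂ hF₂ (derivVec δ₁ hF₁ c)
    have hc : coord δ₁ hF₁ = coord δ₂ hF₂ := rfl
    rw [derivVec_apply, derivVec_apply, derivVec_apply, derivVec_apply, hc,
      LinearEquiv.symm_apply_apply, LinearEquiv.symm_apply_apply]
    congr 1
    apply Subtype.ext
    simp only [coe_derivLin]
    exact leftDeriv_comm_of_bracket_eq_zero h (hF₁.le (Subtype.mem _))
  have key := exp_smul_apply_comm_of_commute hcomm s t (coord δ₁ hF₁ ⟨u, self_mem_biSpan u⟩)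
  rw [flow_eq_coe_flowOn δ₁ hF₁ (flow_mem_of_mem δ₂ hF₂ (self_mem_biSpan u) t),
    flow_eq_coe_flowOn δ₂ hF₂ (flow_mem_of_mem δ₁ hF₁ (self_mem_biSpan u) s),
    flowOn_apply, flowOn_apply]
  have e1 : coord δ₁ hF₁ ⟨flow δ₂ t u, flow_mem_of_mem δ₂ hF₂ (self_mem_biSpan u) t⟩ =
      NormedSpace.exp (t • derivVec δ₂ hF₂) (coord δ₁ hF₁ ⟨u, self_mem_biSpan u⟩) := by
    have : (⟨flow δ₂ t u, flow_mem_of_mem δ₂ hF₂ (self_mem_biSpan u) t⟩ : biSpan u) =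
        flowOn δ₂ hF₂ t ⟨u, self_mem_biSpan u⟩ := Subtype.ext (flow_eq_coe_flowOn δ₂ hF₂ _ t)
    rw [this]; exact coord_flowOn δ₂ hF₂ t _
  have e2 : coord δ₂ hF₂ ⟨flow δ₁ s u, flow_mem_of_mem δ₁ hF₁ (self_mem_biSpan u) s⟩ =
      NormedSpace.exp (s • derivVec δ₁ hF₁) (coord δ₁ hF₁ ⟨u, self_mem_biSpan u⟩) := by
    have : (⟨flow δ₁ s u, flow_mem_of_mem δ₁ hF₁ (self_mem_biSpan u) s⟩ : biSpan u) =
        flowOn δ₁ hF₁ s ⟨u, self_mem_biSpan u⟩ := Subtype.ext (flow_eq_coe_flowOn δ₁ hF₁ _ s)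
    rw [this]; exact coord_flowOn δ₁ hF₁ s _
  rw [e1, e2, key]
  rfl

/-- **Commuting one-parameter subgroups**: if `⁅δ₁, δ₂⁆ = 0` on `R` then `γ_{δ₁}(s)` and
`γ_{δ₂}(t)` commute. [folklore] -/
theorem IsPointDerivation.gammaPt_comm_of_bracket_eq_zero {δ₁ δ₂ : C(G, ℝ) →ₗ[ℝ] ℝ}
    (h₁ : IsPointDerivation δ₁) (h₂ : IsPointDerivation δ₂)
    (hR : (translationFinite G).SeparatesPoints)
    (h : ∀ u ∈ translationFinite G, CompactGroups.bracket δ₁ δ₂ u = 0) (s t : ℝ) :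
    gammaPt δ₁ s * gammaPt δ₂ t = gammaPt δ₂ t * gammaPt δ₁ s :=
  eq_of_forall_translationFinite_apply_eq hR fun u hu => by
    have key := congrArg (fun v : C(G, ℝ) => v 1) (flow_comm_of_bracket_eq_zero h hu s t)
    simp only [h₁.flow_apply (flow_mem δ₂ hu t), h₂.flow_apply (flow_mem δ₁ hu s), one_mul,
      h₂.flow_apply hu, h₁.flow_apply hu] at key
    exact key

end Gamma

/-! ### Differentiating the conjugation by `γ_δ(t)` -/

section ConjDeriv

variable {G : Type*} [TopologicalSpace G] [Group G] [IsTopologicalGroup G] [CompactSpace G]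

/-- `|u| ≤ ‖u‖` pointwise bound turned into a norm bound for a translate. [folklore] -/
theorem norm_lTrans_le (g : G) (w : C(G, ℝ)) : ‖lTrans g w‖ ≤ ‖w‖ :=
  (ContinuousMap.norm_le _ (norm_nonneg _)).mpr fun x => by
    rw [lTrans_apply]; exact w.norm_coe_le_norm _

/-- **Left translation is a sup-norm isometry.** [folklore] -/
theorem norm_lTrans (g : G) (w : C(G, ℝ)) : ‖lTrans g w‖ = ‖w‖ := by
  refine le_antisymm (norm_lTrans_le g w) ?_
  have h := norm_lTrans_le g⁻¹ (lTrans g w)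
  rwa [lTrans_lTrans, mul_inv_cancel, lTrans_one] at h

/-- Inversion is a sup-norm isometry. [folklore] -/
theorem norm_invTrans (u : C(G, ℝ)) : ‖invTrans u‖ = ‖u‖ := by
  have hle : ∀ v : C(G, ℝ), ‖invTrans v‖ ≤ ‖v‖ := fun v =>
    (ContinuousMap.norm_le _ (norm_nonneg _)).mpr fun x => by
      rw [invTrans_apply]; exact v.norm_coe_le_norm _
  refine le_antisymm (hle u) ?_
  have := hle (invTrans u)
  rwa [invTrans_invTrans] at this

/-- Inversion `u ↦ u(·⁻¹)` as a bounded operator on `C(G, ℝ)`. [folklore] -/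
def invTransCLM : C(G, ℝ) →L[ℝ] C(G, ℝ) :=
  LinearMap.mkContinuous (invTrans (G := G)).toLinearMap 1 fun u => by
    rw [one_mul]; exact (norm_invTrans u).le

/-- Unfolding `invTransCLM`. [folklore] -/
@[simp] theorem invTransCLM_apply (u : C(G, ℝ)) : invTransCLM u = invTrans u := rfl

variable {δ : C(G, ℝ) →ₗ[ℝ] ℝ}

/-- **Left translation by `γ_δ(t)` through the flow**: `u(γ_δ(t) ·) = (α_{-t} ǔ)ˇ`. [folklore] -/
theorem IsPointDerivation.lTrans_gammaPt_eq (hδ : IsPointDerivation δ)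
    (hR : (translationFinite G).SeparatesPoints) {v : C(G, ℝ)} (hv : v ∈ translationFinite G)
    (t : ℝ) : lTrans (gammaPt δ t) v = invTrans (flow δ (-t) (invTrans v)) := by
  ext x
  rw [lTrans_apply, invTrans_apply, hδ.flow_apply (invTrans_mem_translationFinite hv), invTrans_apply,
    mul_inv_rev, hδ.gammaPt_neg hR, inv_inv, inv_inv]

/-- The conjugate `a(γ_δ(t) · γ_δ(t)⁻¹) = (α_{-t} a)(γ_δ(t) ·)`. [folklore] -/
theorem IsPointDerivation.conjTrans_gammaPt_eq (hδ : IsPointDerivation δ)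
    (hR : (translationFinite G).SeparatesPoints) {a : C(G, ℝ)} (ha : a ∈ translationFinite G)
    (t : ℝ) : conjTrans (gammaPt δ t) a = lTrans (gammaPt δ t) (flow δ (-t) a) := by
  rw [conjTrans_eq, ← hδ.gammaPt_neg hR, ← hδ.flow_eq_rTrans ha]

/-- Derivative of `t ↦ α_{-t} w`: `-(leftDeriv δ w)` at `t = 0`. [folklore] -/
theorem hasDerivAt_flow_neg_zero {w : C(G, ℝ)} (hw : w ∈ translationFinite G) :
    HasDerivAt (fun t => flow δ (-t) w) (-(leftDeriv δ w)) 0 := by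
  have h := (hasDerivAt_flow δ hw (-0)).scomp (0 : ℝ) (hasDerivAt_neg (0 : ℝ))
  simp only [neg_zero, flow_zero δ hw, neg_one_smul] at h
  exact h

/-- **Derivative of the left translation by `γ_δ(t)`**: `d/dt u(γ_δ(t) ·)|_{t=0} = rightDeriv δ u`. [folklore] -/
theorem IsPointDerivation.hasDerivAt_lTrans_gammaPt (hδ : IsPointDerivation δ)
    (hR : (translationFinite G).SeparatesPoints) {v : C(G, ℝ)} (hv : v ∈ translationFinite G) :
    HasDerivAt (fun t => lTrans (gammaPt δ t) v) (rightDeriv δ v) 0 := by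
  have hSv := invTrans_mem_translationFinite hv
  have h := (invTransCLM (G := G)).hasFDerivAt.comp_hasDerivAt (0 : ℝ) (hasDerivAt_flow_neg_zero (δ := δ) hSv)
  have hfun : (invTransCLM ∘ fun t => flow δ (-t) (invTrans v)) = fun t => lTrans (gammaPt δ t) v := by
    funext t; rw [Function.comp_apply, invTransCLM_apply, hδ.lTrans_gammaPt_eq hR hv]
  rw [hfun] at h
  rwa [invTransCLM_apply, map_neg, ← hδ.rightDeriv_eq hv] at h

/-- Continuity of `t ↦ u(γ_δ(t) ·)` in `C(G, ℝ)`. [folklore] -/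
theorem IsPointDerivation.continuous_lTrans_gammaPt (hδ : IsPointDerivation δ)
    (hR : (translationFinite G).SeparatesPoints) {v : C(G, ℝ)} (hv : v ∈ translationFinite G) :
    Continuous fun t => lTrans (gammaPt δ t) v := by
  simp_rw [hδ.lTrans_gammaPt_eq hR hv]
  exact invTransCLM.continuous.comp ((continuous_flow δ (invTrans_mem_translationFinite hv)).comp
    continuous_neg)

/-- **Differentiating the conjugation action along `γ_δ`**: for representative `a`,
`d/dt a(γ_δ(t) · γ_δ(t)⁻¹)|_{t=0} = rightDeriv δ a - leftDeriv δ a` in `C(G, ℝ)` (sup norm).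
Proof: `κ_{γ(t)} a = L_t (α_{-t} a)` with the isometries `L_t = u ↦ u(γ(t) ·)`, and
`L_t(α_{-t}a) - a - t(D'a - Da) = L_t(α_{-t}a - a + t Da) + (L_t a - a - t D'a) - t (L_t(Da) - Da)`,
each term being `o(t)`. [folklore] -/
theorem IsPointDerivation.hasDerivAt_conjTrans_gammaPt (hδ : IsPointDerivation δ)
    (hR : (translationFinite G).SeparatesPoints) {a : C(G, ℝ)} (ha : a ∈ translationFinite G) :
    HasDerivAt (fun t => conjTrans (gammaPt δ t) a) (rightDeriv δ a - leftDeriv δ a) 0 := by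
  have hDaR : leftDeriv δ a ∈ translationFinite G := leftDeriv_mem δ ha
  rw [hasDerivAt_iff_isLittleO_nhds_zero]
  -- the three little-o pieces
  have hr := hasDerivAt_flow_neg_zero (δ := δ) ha
  rw [hasDerivAt_iff_isLittleO_nhds_zero] at hr
  have h1 : (fun h : ℝ => lTrans (gammaPt δ h) (flow δ (-h) a - a + h • leftDeriv δ a)) =o[𝓝 0]
      fun h => h := by
    refine Asymptotics.IsLittleO.of_norm_left ?_
    refine (hr.norm_left.congr_left fun h => ?_)
    rw [norm_lTrans]
    congr 1
    simp only [zero_add, neg_zero, flow_zero δ ha, smul_neg, sub_neg_eq_add]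
  have hL := hδ.hasDerivAt_lTrans_gammaPt hR ha
  rw [hasDerivAt_iff_isLittleO_nhds_zero] at hL
  have h2 : (fun h : ℝ => lTrans (gammaPt δ h) a - a - h • rightDeriv δ a) =o[𝓝 0] fun h => h := by
    refine hL.congr_left fun h => ?_
    simp only [zero_add, hδ.gammaPt_zero hR, lTrans_one]
  have h3 : (fun h : ℝ => h • (lTrans (gammaPt δ h) (leftDeriv δ a) - leftDeriv δ a)) =o[𝓝 0]
      fun h => h := by
    have hcont : Tendsto (fun h : ℝ => lTrans (gammaPt δ h) (leftDeriv δ a) - leftDeriv δ a)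
        (𝓝 0) (𝓝 0) := by
      have := ((hδ.continuous_lTrans_gammaPt hR hDaR).tendsto 0)
      rw [hδ.gammaPt_zero hR, lTrans_one] at this
      simpa using this.sub_const (leftDeriv δ a)
    have hlo : (fun h : ℝ => lTrans (gammaPt δ h) (leftDeriv δ a) - leftDeriv δ a) =o[𝓝 0]
        fun _ => (1 : ℝ) :=
      (Asymptotics.isLittleO_one_iff ℝ).mpr hcont
    have := (Asymptotics.isBigO_refl (fun h : ℝ => h) (𝓝 0)).smul_isLittleO hlo
    exact this.congr_right fun h => by simp
  have hsum := (h1.add h2).sub h3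
  refine hsum.congr_left fun h => ?_
  -- the algebraic identity
  rw [zero_add, hδ.conjTrans_gammaPt_eq hR ha, hδ.gammaPt_zero hR, conjTrans_one, map_add, map_sub,
    map_smul, smul_sub, smul_sub]
  abel

end ConjDeriv

end Literature.RepresentationTheory.CompactGroups
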